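import Summits.ABC.IUTFork.Thm311RealInd1StripTwistMoverJWUnits
import Summits.ABC.IUTFork.Thm311RealInd1StripNonVacuity
import HarnessLib

/-!
# NON-VACUITY of the faithful twist predicate at `K_v`: a valuation-preserving field automorphism `γ` of `K_v` ACTS AS `γ`

PROOF-ONLY vacuity-audit companion (abc-iut cell, Cor. 3.12 sub-crew, seat abc-iut-c312-1 gen 9; row «R10 IND1-STRIP-MOVER-JW»)
of the named fact `Literature.AnabelianGeometry.AbsoluteAnabelian.DehnTwistTransvectionsOnUnits` (K. Kondo arXiv:2512.09231 §2):
its predicate `MLFClosure.LiftActsOnUnitLogAs C p hp φ T` («THE `φ`-equivariant lift, read on unit logarithms, acts as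
`T`») is shown to be INHABITED BY A NON-IDENTITY `T` at the real log-shell, with inputs all in the tree (cell rule
«vacuity-audit every hypothesis structure», LANA Rem. 8.2.1): for every valuation-preserving ring automorphism `γ` of `K_v`
there is a topological automorphism `c` of `G_v` (abc-iut-c312-1 gen 8, `Real.exists_liftUnits_coe_eq_of_valPreserving`:
conjugation by a semilinear extension of `γ`, THE lift being that extension) with
`(closureAt v).LiftActsOnUnitLogAs p_v _ c γ` — `Real.exists_liftActsOnUnitLogAs_of_valPreserving` (the Galois logarithm
commutes with `γ`: abc-iut-w5-d216 `Real.galoisLog_eq_analyticLogv` + gen 8 `Real.analyticLogv_coe_eq_of_valPreserving`).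
So the predicate is oriented correctly and is satisfied by genuinely non-trivial actions whenever `K_v` has a non-trivial
automorphism; the transvections asserted by the fact are of course NOT of this form (they are not multiplicative).
Nothing here bears on [IUTchIII] Cor. 3.12; no side taken.  [claim: Mochizuki2012, status: disputed];
[cite: Kondo2025OuterAutMLF, §2 proof of Thm 2.3 p.10]; [cite: MochizukiAbsTopIII2015, Proposition 3.2 (iv) p.72].
-/

set_option autoImplicit false

noncomputable section

namespace Summit.ABC.IUTFork.Thm311.Real

open NumberField IsDedekindDomain Literature.IUT.LogVolume
open Literature.AnabelianGeometry.AbsoluteAnabelian Literature.IUT.HodgeArakelov Literature.IUT.HodgeArakelov.AbsTopMonoids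

variable {F : Type} [Field F] [NumberField F] (v : HeightOneSpectrum (𝓞 F))

/-- **A valuation-preserving `γ ∈ Aut(K_v)` acts, in the sense of the faithful twist predicate, as `γ` itself**: with `c` the
strip automorphism of gen 8's `exists_liftUnits_coe_eq_of_valPreserving` (`liftUnits v c = γ` on `𝒪_v^×`),
`(closureAt v).LiftActsOnUnitLogAs p_v _ c γ` — a base unit `x = u` of `𝒪^⊳_{K̄_v}` is `toOUnits v u₀`
(`Real.mem_fixedBy_top_iff`), THE lift carries it to `liftUnits v c u₀ = γ u₀` (`coe_liftM_toOUnits`), and the Galois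
logarithm commutes with `γ` (`galoisLog_eq_analyticLogv`, `analyticLogv_coe_eq_of_valPreserving`).
[claim: Mochizuki2012, status: disputed] [cite: MochizukiAbsTopIII2015, Proposition 3.2 (iv) p.72] -/
theorem exists_liftActsOnUnitLogAs_of_valPreserving [Fact (closureAt v).residueChar.Prime]
    (hp : ValuativeRel.valuation (v.adicCompletion F) (closureAt v).residueChar < 1)
    (γ : v.adicCompletion F ≃+* v.adicCompletion F)
    (hγ : ∀ x, ValuativeRel.valuation (v.adicCompletion F) (γ x) = ValuativeRel.valuation (v.adicCompletion F) x) :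
    ∃ c : Gal v ≃ₜ* Gal v, (closureAt v).LiftActsOnUnitLogAs (closureAt v).residueChar hp c γ := by
  obtain ⟨c, hc⟩ := exists_liftUnits_coe_eq_of_valPreserving v hγ
  refine ⟨c, ?_⟩
  intro x x' u u' t t' hxu hx hx' hlift ht ht'
  -- the unit `x` of `𝒪^⊳_{K̄_v}` with value in `K_v` is `toOUnits v u₀`
  obtain ⟨w, hw⟩ := hxu
  have hwfix : w ∈ Literature.IUT.HodgeArakelov.fixedBy (galRho v) ⊤ := by
    rw [Literature.IUT.HodgeArakelov.mem_fixedBy]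
    intro σ _
    apply Units.ext; apply Subtype.ext
    rw [coe_galRho, hw, hx, AlgEquiv.commutes]
  obtain ⟨u₀, hu₀⟩ := (mem_fixedBy_top_iff v w).mp hwfix
  -- `u = u₀` and `u' = liftUnits v c u₀ = γ u₀` in `K_v`
  have hinj := (algebraMap (v.adicCompletion F) (AlgebraicClosure (v.adicCompletion F))).injective
  have hu : u = ((u₀ : ↥(v.adicCompletionIntegers F)) : v.adicCompletion F) := by
    apply hinj
    rw [← hx, ← hw, hu₀]
    exact val_toOUnits v u₀
  have hu' : u' = ((liftUnits v c u₀ : ↥(v.adicCompletionIntegers F)) : v.adicCompletion F) := by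
    apply hinj
    rw [← hx', ← hlift, ← coe_liftM_toOUnits v c u₀, ← hu₀, hw]
  -- the Galois logarithms
  have htu : t = galoisLog v (Additive.ofMul u₀) := by
    apply hinj
    rw [← ht, hu, algebraMap_galoisLog]
    rfl
  have htu' : t' = galoisLog v (Additive.ofMul (liftUnits v c u₀)) := by
    apply hinj
    rw [← ht', hu', algebraMap_galoisLog]
    rfl
  rw [htu, htu', galoisLog_eq_analyticLogv]
  exact analyticLogv_coe_eq_of_valPreserving F v hγ u₀ (liftUnits v c u₀) (hc u₀)

end Summit.ABC.IUTFork.Thm311.Real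

end
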